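import Summits.CriticalPhenomena.CardyFormulaZ2.Theorems.CardySelfRefinementLagHandOffNoTouchCountableTail
import Literature.Probability.RandomPlanarGeometry.CurveClassStopAtMeasurable
import HarnessLib

/-!
# One-sided touching of a line is null off countably many levels

Crux `stmt-CriticalPhenomena-10268` (`…Theses.CardySelfRefinement.LagHandOff`), line
hitting-tournament, registered stub `stub_quadTransfer_noTouchCountable`.  PURE MEASURE THEORY and
topology of planar curves modulo reparametrisation; no new definitions (local notations only).

For a direction `u` write `p(z) = Re(ū z)`.  A representative `c` of a curve class **touches the
line `{p = a}` one-sidedly** if on some parameter window `[s, v]` it stays in `{p ≤ a}`, is on the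
line at some `t ∈ [s, v]`, and is constant neither on `[s, t]` nor on `[t, v]`.  For ANY probability
law `ν` on curve classes under which, almost surely, no representative *slides* along a line of
direction `iu` (`p ∘ c` constant on `[s, t]`, `s < t` ⇒ `c` constant there), the set of levels `a`
at which one-sided touching is not almost surely absent is COUNTABLE.

Proof.  Off the no-sliding null set, a one-sided touch at level `a` forces `p ∘ c < a` somewhere on
`[s, t]` and somewhere on `[t, v]`, hence rationals `b < q < a` above both values; the windows of
the alternating first-hitting recursion between the closed half-planes `F = {p ≤ b}` and
`G = {q ≤ p}` (`stub_noTouchCountable_window`, file `…NoTouchCountableTail`) catch `t`, so `a` is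
the maximum of `p` over the trace of the class-level surgery
`stopAt F (startFrom G ((startFrom F ∘ startFrom G)^[k] γ))` for some `k` (`excMax_mk`).  These
countably many functionals `EM⟦u, b, q, k⟧` are Borel on `CurveClass ℂ` (the surgeries are Borel
for closed sets, `CurveClass.measurable_stopAt/startFrom`; the trace-maximum of `p` is Lipschitz)
and representative independent (`CurveClass.stopAt_mk_holds`, `startFrom_mk_holds`).  A finite
measure has countably many atoms in the law of each real Borel functional
(`Measure.countable_meas_level_set_pos`), and a level outside all these atom sets is good almost
surely (`measure_mono_null`).
-/

noncomputable section

open MeasureTheory Filter Set Topology Metric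
open scoped unitInterval ENNReal
open Literature.Probability.RandomPlanarGeometry

namespace Summit.CriticalPhenomena.CardyFormulaZ2.Cruxes.LagHandOff.HittingTournament

-- BEGIN shared notations (identical to `…NoTouchCountableTail`)
/-- The tail of a curve `c` from parameter `r`, rescaled to `[0,1]` (local notation, as in
`…NoTouchCountableTail`). -/
local notation3 "tail⟦" c ", " r "⟧" =>
  (Curve.mk (ContinuousMap.comp (Curve.toContinuousMap c)
    (Curve.affineClamp (Subtype.val (r : unitInterval))
      (1 - Subtype.val (r : unitInterval)))) : Curve ℂ)

/-- The first hitting of `S` after parameter `r` (local notation, as in `…NoTouchCountableTail`). -/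
local notation3 "hit⟦" S ", " c ", " r "⟧" =>
  (Curve.affineClamp (Subtype.val (r : unitInterval)) (1 - Subtype.val (r : unitInterval))
    ⟨Curve.hitParam S tail⟦c, r⟧, Curve.hitParam_mem_Icc S tail⟦c, r⟧⟩ : unitInterval)
-- END shared notations

/-- The closed half-plane `{Re(ū z) ≤ b}` (local notation). -/
local notation3 "low⟦" u ", " b "⟧" => {z : ℂ | (starRingEnd ℂ u * z).re ≤ b}

/-- The closed half-plane `{q ≤ Re(ū z)}` (local notation). -/
local notation3 "high⟦" u ", " q "⟧" => {z : ℂ | q ≤ (starRingEnd ℂ u * z).re}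

/-- The return times of the alternating recursion between `low⟦u, b⟧` and `high⟦u, q⟧` along the
curve `c`: `ret 0 = 0`, `ret (k+1) = hit⟦low, c, hit⟦high, c, ret k⟧⟧` (local notation for the
`Nat.rec` term). -/
local notation3 "ret⟦" u ", " b ", " q ", " c ", " k "⟧" =>
  (Nat.rec (motive := fun _ => unitInterval) (0 : unitInterval)
    (fun _ τ => hit⟦low⟦u, b⟧, c, hit⟦high⟦u, q⟧, c, τ⟧⟧) k : unitInterval)

/-- The maximum of `Re(ū ·)` over the trace of a curve class (local notation). -/
local notation3 "supP⟦" u ", " γ "⟧" =>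
  sSup ((fun z : ℂ => (starRingEnd ℂ u * z).re) '' CurveClass.range γ)

/-- The **excursion maxima** functional `EM⟦u, b, q, k⟧ : CurveClass ℂ → ℝ`: the maximum of `Re(ū ·)`
over the trace of the class between its `k`-th arrival in `high⟦u, q⟧` (counted by the recursion
"final segment from `high`, then final segment from `low`") and the next return to `low⟦u, b⟧`
(local notation). -/
local notation3 "EM⟦" u ", " b ", " q ", " k "⟧" =>
  fun γ : CurveClass ℂ => supP⟦u, CurveClass.stopAt low⟦u, b⟧ (CurveClass.startFrom high⟦u, q⟧
    ((fun γ' : CurveClass ℂ => CurveClass.startFrom low⟦u, b⟧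
      (CurveClass.startFrom high⟦u, q⟧ γ'))^[k] γ))⟧

/-! ### Half-planes -/

/-- `z ↦ Re(ū z)` is continuous. -/
theorem continuous_dirProj (u : ℂ) : Continuous fun z : ℂ => (starRingEnd ℂ u * z).re :=
  Complex.continuous_re.comp (continuous_const.mul continuous_id)

/-- `|Re(ū x) - Re(ū y)| ≤ ‖u‖ · dist x y`. -/
theorem abs_dirProj_sub_le (u x y : ℂ) :
    |(starRingEnd ℂ u * x).re - (starRingEnd ℂ u * y).re| ≤ ‖u‖ * dist x y := by
  rw [← Complex.sub_re, ← mul_sub, dist_eq_norm, ← Complex.norm_conj u, ← norm_mul]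
  exact Complex.abs_re_le_norm _

/-- `low⟦u, b⟧` is closed. -/
theorem isClosed_low (u : ℂ) (b : ℝ) : IsClosed low⟦u, b⟧ :=
  isClosed_le (continuous_dirProj u) continuous_const

/-- `high⟦u, q⟧` is closed. -/
theorem isClosed_high (u : ℂ) (q : ℝ) : IsClosed high⟦u, q⟧ :=
  isClosed_le continuous_const (continuous_dirProj u)

/-- For `b < q` the two half-planes are disjoint. -/
theorem disjoint_low_high (u : ℂ) {b q : ℝ} (hbq : b < q) : Disjoint low⟦u, b⟧ high⟦u, q⟧ :=
  Set.disjoint_left.2 fun _ hz hz' => absurd (le_trans hz' hz) (not_le.2 hbq)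

/-! ### Curve level: the touching level is a window maximum -/

/-- Iterating the surgery "final segment from `high`, then final segment from `low`" `k` times on a
curve gives the tail from the `k`-th return time. -/
theorem iterate_startFrom_eq_tail (u : ℂ) (b q : ℝ) (c : Curve ℂ) (k : ℕ) :
    (fun γ : Curve ℂ => (γ.startFrom high⟦u, q⟧).startFrom low⟦u, b⟧)^[k] c =
      tail⟦c, ret⟦u, b, q, c, k⟧⟧ := by
  induction k with
  | zero => exact (tail_zero c).symm
  | succ k ih =>
    rw [Function.iterate_succ_apply', ih, startFrom_tail, startFrom_tail]

/-- **Capture of a touching level by a window.** If `Re(ū c) ≤ a` on `[r₁, r₂]`, `= a` at some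
`t ∈ [r₁, r₂]`, and `≤ b` at `r₁` and at `r₂`, where `b < q ≤ a`, then `a` is the maximum of
`Re(ū ·)` over the image of a window `[hit⟦high, c, ret k⟧, ret (k+1)]`. -/
theorem exists_window_sSup_eq (u : ℂ) (c : Curve ℂ) {b q a : ℝ} (hbq : b < q) (hqa : q ≤ a)
    {r₁ t r₂ : I} (h₁t : r₁ ≤ t) (htr₂ : t ≤ r₂) (h₁ : (starRingEnd ℂ u * c r₁).re ≤ b)
    (h₂ : (starRingEnd ℂ u * c r₂).re ≤ b) (hle : ∀ r ∈ Icc r₁ r₂, (starRingEnd ℂ u * c r).re ≤ a)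
    (ht : (starRingEnd ℂ u * c t).re = a) :
    ∃ k, sSup ((fun z : ℂ => (starRingEnd ℂ u * z).re) '' (c '' Icc hit⟦high⟦u, q⟧, c,
      ret⟦u, b, q, c, k⟧⟧ ret⟦u, b, q, c, k + 1⟧)) = a := by
  have hF : IsClosed low⟦u, b⟧ := isClosed_low u b
  have hG : IsClosed high⟦u, q⟧ := isClosed_high u q
  -- the last visit to `low` before `t`
  have hAc : IsClosed {r : I | r ≤ t ∧ c r ∈ low⟦u, b⟧} :=
    isClosed_Iic.inter (hF.preimage c.continuous)
  obtain ⟨α, ⟨hαt, hαF⟩, hαmax⟩ := hAc.isCompact.exists_isGreatest ⟨r₁, h₁t, h₁⟩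
  have htG : c t ∈ high⟦u, q⟧ := show q ≤ (starRingEnd ℂ u * c t).re by rw [ht]; exact hqa
  have hαt' : α < t := by
    refine lt_of_le_of_ne hαt fun h => ?_
    rw [h] at hαF
    exact Set.disjoint_left.1 (disjoint_low_high u hbq) hαF htG
  have hno : ∀ r : I, α < r → r ≤ t → c r ∉ low⟦u, b⟧ := fun r hr hrt hrF =>
    absurd (hαmax ⟨hrt, hrF⟩) (not_le.2 hr)
  obtain ⟨k, hσ1, hσ2, hτ1⟩ := stub_noTouchCountable_window c low⟦u, b⟧ high⟦u, q⟧ hF hG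
    (disjoint_low_high u hbq) (fun r => hit⟦low⟦u, b⟧, c, r⟧) (fun r => hit⟦high⟦u, q⟧, c, r⟧)
    (fun r => le_hit _ c r) (fun r hr => apply_hit_mem hF hr) (fun r r' hr hS => hit_le hr hS)
    (fun r => le_hit _ c r) (fun r hr => apply_hit_mem hG hr) (fun r r' hr hS => hit_le hr hS)
    (fun k => ret⟦u, b, q, c, k⟧) rfl (fun k => rfl) α t hαt' hαF htG hno
  have hτ2 : ret⟦u, b, q, c, k + 1⟧ ≤ r₂ := hit_le (hσ2.trans htr₂) h₂
  have hr₁α : r₁ ≤ α := hαmax ⟨h₁t, h₁⟩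
  refine ⟨k, IsGreatest.csSup_eq ⟨⟨c t, ⟨t, ⟨hσ2, hτ1⟩, rfl⟩, ht⟩, ?_⟩⟩
  rintro _ ⟨_, ⟨r, ⟨hr1, hr2⟩, rfl⟩, rfl⟩
  exact hle r ⟨hr₁α.trans (hσ1.le.trans hr1), hr2.trans hτ2⟩

/-! ### Class level: the countably many Borel functionals -/

/-- One-sided estimate `supP⟦u, γ₁⟧ ≤ supP⟦u, γ₂⟧ + ‖u‖ · dist γ₁ γ₂` (every point of a trace is
within the reparametrisation distance of the other trace). -/
theorem supP_le_add (u : ℂ) (γ₁ γ₂ : CurveClass ℂ) : supP⟦u, γ₁⟧ ≤ supP⟦u, γ₂⟧ + ‖u‖ * dist γ₁ γ₂ := by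
  obtain ⟨c₁, rfl⟩ := CurveClass.surjective_mk γ₁
  obtain ⟨c₂, rfl⟩ := CurveClass.surjective_mk γ₂
  simp only [CurveClass.range_mk, CurveClass.dist_mk_mk]
  have hne : ((fun z : ℂ => (starRingEnd ℂ u * z).re) '' c₁.range).Nonempty :=
    c₁.range_nonempty.image _
  have hbdd₂ : BddAbove ((fun z : ℂ => (starRingEnd ℂ u * z).re) '' c₂.range) :=
    (c₂.isCompact_range.image (continuous_dirProj u)).bddAbove
  refine csSup_le hne ?_
  rintro _ ⟨x, ⟨s, rfl⟩, rfl⟩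
  obtain ⟨y, hy, hdist⟩ := c₂.isCompact_range.exists_infDist_eq_dist c₂.range_nonempty (c₁ s)
  have h1 : Metric.infDist (c₁ s) c₂.range ≤ dist c₁ c₂ := Curve.infDist_range_le c₁ c₂ s
  have h2 := abs_dirProj_sub_le u (c₁ s) y
  have h3 : (starRingEnd ℂ u * y).re ≤ sSup ((fun z : ℂ => (starRingEnd ℂ u * z).re) '' c₂.range) :=
    le_csSup hbdd₂ ⟨y, hy, rfl⟩
  rw [hdist] at h1
  have h4 := le_abs_self ((starRingEnd ℂ u * c₁ s).re - (starRingEnd ℂ u * y).re)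
  show (starRingEnd ℂ u * c₁ s).re ≤ _
  nlinarith [norm_nonneg u]

/-- `γ ↦ supP⟦u, γ⟧` is `‖u‖`-Lipschitz, hence continuous. -/
theorem continuous_supP (u : ℂ) : Continuous fun γ : CurveClass ℂ => supP⟦u, γ⟧ := by
  refine (LipschitzWith.of_le_add_mul ‖u‖₊ fun γ₁ γ₂ => ?_).continuous
  rw [coe_nnnorm]
  exact supP_le_add u γ₁ γ₂

/-- `EM⟦u, b, q, k⟧` is Borel measurable on curve classes. -/
theorem measurable_excMax (u : ℂ) (b q : ℝ) (k : ℕ) : Measurable EM⟦u, b, q, k⟧ := by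
  have hstep : Measurable fun γ' : CurveClass ℂ => CurveClass.startFrom low⟦u, b⟧
      (CurveClass.startFrom high⟦u, q⟧ γ') :=
    (CurveClass.measurable_startFrom (isClosed_low u b)).comp
      (CurveClass.measurable_startFrom (isClosed_high u q))
  exact (continuous_supP u).measurable.comp <|
    (CurveClass.measurable_stopAt (isClosed_low u b)).comp <|
      (CurveClass.measurable_startFrom (isClosed_high u q)).comp (hstep.iterate k)

/-- **Representative formula.** On the class of any curve `c`, `EM⟦u, b, q, k⟧` is the maximum of
`Re(ū ·)` over the image of the parameter window `[hit⟦high, c, ret k⟧, ret (k+1)]`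
(representative independence of the surgeries, `CurveClass.stopAt_mk_holds` /
`startFrom_mk_holds`, and `range_stopAt_tail`). -/
theorem excMax_mk (u : ℂ) (b q : ℝ) (k : ℕ) (c : Curve ℂ) :
    EM⟦u, b, q, k⟧ (CurveClass.mk c) = sSup ((fun z : ℂ => (starRingEnd ℂ u * z).re) ''
      (c '' Icc hit⟦high⟦u, q⟧, c, ret⟦u, b, q, c, k⟧⟧ ret⟦u, b, q, c, k + 1⟧)) := by
  have hF : IsClosed low⟦u, b⟧ := isClosed_low u b
  have hG : IsClosed high⟦u, q⟧ := isClosed_high u q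
  have hsemi : Function.Semiconj CurveClass.mk
      (fun γ : Curve ℂ => (γ.startFrom high⟦u, q⟧).startFrom low⟦u, b⟧)
      (fun γ' : CurveClass ℂ => CurveClass.startFrom low⟦u, b⟧
        (CurveClass.startFrom high⟦u, q⟧ γ')) := fun γ => by
    show CurveClass.mk ((γ.startFrom high⟦u, q⟧).startFrom low⟦u, b⟧) =
      CurveClass.startFrom low⟦u, b⟧ (CurveClass.startFrom high⟦u, q⟧ (CurveClass.mk γ))
    rw [CurveClass.startFrom_mk_holds _ hG, CurveClass.startFrom_mk_holds _ hF]
  show sSup ((fun z : ℂ => (starRingEnd ℂ u * z).re) '' CurveClass.range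
    (CurveClass.stopAt low⟦u, b⟧ (CurveClass.startFrom high⟦u, q⟧
    ((fun γ' : CurveClass ℂ => CurveClass.startFrom low⟦u, b⟧
      (CurveClass.startFrom high⟦u, q⟧ γ'))^[k] (CurveClass.mk c))))) = _
  rw [← (hsemi.iterate_right k).eq, iterate_startFrom_eq_tail,
    CurveClass.startFrom_mk_holds _ hG, startFrom_tail, CurveClass.stopAt_mk_holds _ hF,
    CurveClass.range_mk, range_stopAt_tail]

/-! ### The theorem -/

/-- Registered stub `stub_quadTransfer_noTouchCountable` (line hitting-tournament of crux
`stmt-CriticalPhenomena-10268`).  For any probability law `ν` on planar curve classes and any unit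
direction `u`: if `ν`-almost surely no representative slides along a line `{Re(ū z) = const}`
(constancy of `Re(ū c)` on a nondegenerate parameter interval forces constancy of `c` there), then
for all but COUNTABLY many levels `a`, `ν`-almost surely no representative touches the line
`{Re(ū z) = a}` one-sidedly from `{Re(ū z) ≤ a}` while being non-constant on both sides of the
touching parameter.  Proof: the bad levels of a class off the no-sliding null set are values of the
countably many Borel functionals `EM⟦u, b, q, k⟧` (`b, q ∈ ℚ`, `k ∈ ℕ`; `exists_window_sSup_eq`,
`excMax_mk`), and each real Borel functional has countably many atoms under the finite measure `ν`
(`Measure.countable_meas_level_set_pos`). -/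
theorem stub_quadTransfer_noTouchCountable : ∀ (ν : Measure (CurveClass ℂ)) [IsProbabilityMeasure ν] (u : ℂ), ‖u‖ = 1 → (∀ᵐ γ ∂ν, ∀ c : Curve ℂ, CurveClass.mk c = γ → ∀ s t : I, s < t → (∀ r ∈ Set.Icc s t, (starRingEnd ℂ u * c r).re = (starRingEnd ℂ u * c s).re) → ∀ r ∈ Set.Icc s t, c r = c s) → Set.Countable {a : ℝ | ¬ ∀ᵐ γ ∂ν, ∀ c : Curve ℂ, CurveClass.mk c = γ → ∀ s v : I, (∀ r ∈ Set.Icc s v, (starRingEnd ℂ u * c r).re ≤ a) → ∀ t ∈ Set.Icc s v, (starRingEnd ℂ u * c t).re = a → (∀ r ∈ Set.Icc s t, c r = c t) ∨ (∀ r ∈ Set.Icc t v, c r = c t)} := by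
  intro ν _ u _ hNS
  -- the countable candidate set: atoms of the laws of the functionals `EM⟦u, b, q, k⟧`
  refine Set.Countable.mono (s₂ := ⋃ i : ℚ × ℚ × ℕ,
    {a : ℝ | 0 < ν {γ | EM⟦u, (i.1 : ℝ), (i.2.1 : ℝ), i.2.2⟧ γ = a}}) ?_
    (Set.countable_iUnion fun i => Measure.countable_meas_level_set_pos
      (measurable_excMax u (i.1 : ℝ) (i.2.1 : ℝ) i.2.2))
  intro a ha
  by_contra hnot
  simp only [mem_iUnion, mem_setOf_eq, not_exists, not_lt, nonpos_iff_eq_zero] at hnot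
  apply ha
  have hnull : ν ({γ | ¬ ∀ c : Curve ℂ, CurveClass.mk c = γ → ∀ s t : I, s < t →
      (∀ r ∈ Set.Icc s t, (starRingEnd ℂ u * c r).re = (starRingEnd ℂ u * c s).re) →
      ∀ r ∈ Set.Icc s t, c r = c s} ∪
      ⋃ i : ℚ × ℚ × ℕ, {γ | EM⟦u, (i.1 : ℝ), (i.2.1 : ℝ), i.2.2⟧ γ = a}) = 0 :=
    measure_union_null (ae_iff.1 hNS) (measure_iUnion_null fun i => hnot i)
  filter_upwards [measure_eq_zero_iff_ae_notMem.1 hnull] with γ hγ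
  simp only [mem_union, mem_setOf_eq, mem_iUnion, not_or, not_not, not_exists] at hγ
  obtain ⟨hslide, hval⟩ := hγ
  intro c hc s v hle t ht hft
  by_contra hbad
  push Not at hbad
  obtain ⟨hbad1, hbad2⟩ := hbad
  -- `Re(ū c) < a` somewhere on `[s, t]` (no sliding) ...
  have hex₁ : ∃ r₁ ∈ Set.Icc s t, (starRingEnd ℂ u * c r₁).re < a := by
    by_contra H
    push Not at H
    have Heq : ∀ r ∈ Set.Icc s t, (starRingEnd ℂ u * c r).re = a := fun r hr =>
      le_antisymm (hle r ⟨hr.1, hr.2.trans ht.2⟩) (H r hr)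
    rcases eq_or_lt_of_le ht.1 with hst | hst
    · obtain ⟨r, hr, hne⟩ := hbad1
      rw [hst, Set.Icc_self, mem_singleton_iff] at hr
      exact hne (by rw [hr])
    · have hcs := hslide c hc s t hst (fun r hr => by rw [Heq r hr, Heq s ⟨le_rfl, hst.le⟩])
      obtain ⟨r, hr, hne⟩ := hbad1
      exact hne (by rw [hcs r hr, hcs t ⟨hst.le, le_rfl⟩])
  -- ... and somewhere on `[t, v]`
  have hex₂ : ∃ r₂ ∈ Set.Icc t v, (starRingEnd ℂ u * c r₂).re < a := by
    by_contra H
    push Not at H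
    have Heq : ∀ r ∈ Set.Icc t v, (starRingEnd ℂ u * c r).re = a := fun r hr =>
      le_antisymm (hle r ⟨ht.1.trans hr.1, hr.2⟩) (H r hr)
    rcases eq_or_lt_of_le ht.2 with htv | htv
    · obtain ⟨r, hr, hne⟩ := hbad2
      rw [← htv, Set.Icc_self, mem_singleton_iff] at hr
      exact hne (by rw [hr])
    · have hct := hslide c hc t v htv (fun r hr => by rw [Heq r hr, Heq t ⟨le_rfl, htv.le⟩])
      obtain ⟨r, hr, hne⟩ := hbad2
      exact hne (hct r hr)
  obtain ⟨r₁, hr₁, h₁⟩ := hex₁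
  obtain ⟨r₂, hr₂, h₂⟩ := hex₂
  -- rational levels `max (p r₁) (p r₂) < b < q < a`, and the window catching `t`
  obtain ⟨b, hb₁, hb₂⟩ := exists_rat_btwn (max_lt h₁ h₂)
  obtain ⟨q, hq₁, hq₂⟩ := exists_rat_btwn hb₂
  obtain ⟨k, hk⟩ := exists_window_sSup_eq u c hq₁ hq₂.le hr₁.2 hr₂.1
    ((le_max_left _ _).trans hb₁.le) ((le_max_right _ _).trans hb₁.le)
    (fun r hr => hle r ⟨hr₁.1.trans hr.1, hr.2.trans hr₂.2⟩) hft
  refine hval (b, q, k) ?_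
  rw [← hc]
  exact (excMax_mk u b q k c).trans hk

end Summit.CriticalPhenomena.CardyFormulaZ2.Cruxes.LagHandOff.HittingTournament

end
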